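import Summits.CriticalPhenomena.SAWScalingLimit.Theorems.SAWDevelopingMapObservableToSLEHalfPlaneArchTightnessStrips
import HarnessLib

/-!
# Crux `SAWDevelopingMap.ObservableToSLE` (stmt-CriticalPhenomena-10472), line
`floor-ratio-restriction-bootstrap`: half-plane arch tightness at BOUNDED SPAN (flat floors)

Landing target:
`Summits/CriticalPhenomena/SAWScalingLimit/Theorems/SAWDevelopingMapObservableToSLEHalfPlaneArchTightnessBoundedSpan.lean`
(`--supports stmt-CriticalPhenomena-10472`).

The registered anchor stub `stub_halfPlaneArchTightness` asks, for every `ε > 0`, for ONE `K` such that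
for ALL spans `n ≥ 1` the `x_c`-mass of the half-plane arches `s → t` (`|mid s - mid t| ≤ n`) of a
finite domain `Λ` above the floor line through `mid s` that reach distance `≥ K n` from `mid s` is at
most `ε · Z_B(s, t)`, `B` the upper half-box of radius `2 K n` — an OPEN estimate (uniformity in `n`).
This file proves the BOUNDED-SPAN case `n ≤ N₀` for vertical ("flat") floor mid-edges
`s = s_x = {(x - e₁, 1), (x, 0)}`, where the far mass is the tail of a convergent series
(sibling file `…HalfPlaneArchTightnessStrips.lean`: half-strip exhaustion `S_x(N)`, translation
invariance `archMass_halfStrip_eq`, tail threshold `exists_archThreshold`):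

* `farArchMass_add_nearArchMass`, `archMass_le_nearArchMass`: far/near splitting of `Z` and
  "the walks of a sub-domain inside the open disc of radius `R` are near";
* `eq_floorEdge_of_boundary`: a boundary mid-edge of a domain in the rows `≥ x₁` with midpoint on the
  floor line of `s_x` is a vertical floor mid-edge `t_y`, `y₁ = x₁` (so `|y₀ - x₀| = |mid s_x - mid t_y|`,
  `dist_hexMidpoint_floorEdge` of `…RestrictionCocycleHelpersLattice.lean`);
* **`stub_halfPlaneArchTightness_boundedSpanFlat`**: the registered statement of the anchor with the
  two extra hypotheses `n ≤ N₀` and `s = s_x` (with `K = 4 N₁ + 5`, `N₁` the largest tail threshold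
  over the finitely many offsets `0 < |d| ≤ N₀`).

Not covered here: diagonal ("zigzag") floor mid-edges `s = {(x, 0), (x, 1)}`, `{(x + e₀, 0), (x, 1)}`,
which the anchor's hypotheses also admit (the domain then lies in the rows of `(z, 1)`, `z₁ ≥ x₁`, and
`(z, 0)`, `z₁ ≥ x₁ + 1`); they reduce to the flat case one row up by stripping the forced first and
last steps of every arch.
-/

noncomputable section

open scoped BigOperators Topology Classical
open Filter Set
open Literature.Probability.LatticeModels (HexVertex hexGraph hexCenter triEmbed triZeta Site
  triZeta_re triZeta_im)
open Literature.Probability.RandomPlanarGeometry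
open Literature.Probability.RandomPlanarGeometry.SAW
open Literature.Probability.RandomPlanarGeometry.SAW.HV
open Literature.Probability.Percolation (hexCenter_im hexCenter_re)

namespace Summit.CriticalPhenomena.SAWScalingLimit.Theorems.ObservableToSLE.FloorRatio

/-! ### Far/near splitting of the arch mass -/

/-- `Z_Λ(s,t) = far mass + near mass` for any threshold `R`. [cite: DuminilCopinSmirnov2012, §1] -/
theorem farArchMass_add_nearArchMass (Λ : Finset HexVertex) (s t : Sym2 HexVertex) (R : ℝ) :
    (∑ γ : HexMidEdgeSAW Λ s t,
        if ∃ v ∈ γ.verts, R ≤ dist (hexCenter v) (hexMidpoint s)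
        then hexCriticalFugacity ^ γ.length else 0) +
      (∑ γ : HexMidEdgeSAW Λ s t,
        if ∃ v ∈ γ.verts, R ≤ dist (hexCenter v) (hexMidpoint s)
        then 0 else hexCriticalFugacity ^ γ.length) =
      ∑ γ : HexMidEdgeSAW Λ s t, hexCriticalFugacity ^ γ.length := by
  rw [← Finset.sum_add_distrib]
  refine Finset.sum_congr rfl fun γ _ => ?_
  split_ifs <;> simp

/-- **Walks of a near sub-domain are near.**  If `Λ ⊆ Λ'` and every vertex of `Λ` is at distance
`< R` from `mid s`, then `Z_Λ(s,t)` is at most the near mass of `Λ'` at threshold `R` (exact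
restriction: the walks of `Λ` are walks of `Λ'` with the same vertices).
[cite: LawlerSchrammWerner2004SAW, §3.4 ("SAW satisfies restriction")] -/
theorem archMass_le_nearArchMass {Λ Λ' : Finset HexVertex} (h : Λ ⊆ Λ') (s t : Sym2 HexVertex)
    (R : ℝ) (hnear : ∀ w ∈ Λ, dist (hexCenter w) (hexMidpoint s) < R) :
    ∑ γ : HexMidEdgeSAW Λ s t, hexCriticalFugacity ^ γ.length ≤
      ∑ γ : HexMidEdgeSAW Λ' s t,
        if ∃ v ∈ γ.verts, R ≤ dist (hexCenter v) (hexMidpoint s)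
        then 0 else hexCriticalFugacity ^ γ.length := by
  have key := sum_verts_le_of_subset h s t
    (fun l => if ∃ v ∈ l, R ≤ dist (hexCenter v) (hexMidpoint s)
      then 0 else hexCriticalFugacity ^ l.length) fun l => by
      split_ifs
      · exact le_rfl
      · exact pow_nonneg hexCriticalFugacity_pos_lt_one.1.le _
  refine le_trans (le_of_eq (Finset.sum_congr rfl fun γ _ => ?_)) key
  rw [if_neg]
  · rfl
  · rintro ⟨v, hv, hRv⟩
    exact (hnear v (γ.subset v hv)).not_ge hRv

/-! ### The floor mid-edges on the line of `s_x` -/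

/-- **Boundary mid-edges on the floor line are vertical floor mid-edges.**  If `Λ` lies in the rows
`≥ x₁` and `t ∈ ∂Ω(Λ)` has its midpoint on the horizontal line through `mid s_x`, then
`t = t_y = {(y - e₁, 1), (y, 0)}` for a cell `y` of the row `x₁` with `(y, 0) ∈ Λ`. [folklore] -/
theorem eq_floorEdge_of_boundary {Λ : Finset HexVertex} {x : Site 2} {t : Sym2 HexVertex}
    (hΛ : ∀ v ∈ Λ, x 1 ≤ v.1 1) (ht : t ∈ hexDomainBoundary Λ)
    (him : (hexMidpoint t).im = (hexMidpoint s((x - Pi.single 1 1, 1), (x, 0))).im) :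
    ∃ y : Site 2, y 1 = x 1 ∧ t = s((y - Pi.single 1 1, 1), (y, 0)) ∧ (y, (0 : Fin 2)) ∈ Λ := by
  obtain ⟨hadj, u, v, rfl, hv, hu⟩ := ht
  rw [SimpleGraph.mem_edgeSet] at hadj
  obtain ⟨p, i⟩ := u
  obtain ⟨q, j⟩ := v
  have hq : x 1 ≤ q 1 := hΛ _ hv
  rw [im_hexMidpoint_floorEdge, hexMidpoint_mk, Complex.div_ofNat_im, Complex.add_im, hexCenter_im,
    hexCenter_im] at him
  have hc : (Real.sqrt 3 / 2 : ℝ) ≠ 0 := by positivity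
  have hsum : ((p 1 : ℝ) + (((i : ℕ) : ℝ) + 1) / 3 + ((q 1 : ℝ) + (((j : ℕ) : ℝ) + 1) / 3)) =
      2 * (x 1 : ℝ) := by
    have h2 : ((p 1 : ℝ) + (((i : ℕ) : ℝ) + 1) / 3 + ((q 1 : ℝ) + (((j : ℕ) : ℝ) + 1) / 3)) *
        (Real.sqrt 3 / 2) = (2 * (x 1 : ℝ)) * (Real.sqrt 3 / 2) := by linear_combination 2 * him
    exact mul_right_cancel₀ hc h2
  rw [hexGraph_adj_iff_coord] at hadj
  rcases hadj with ⟨rfl, rfl, h⟩ | ⟨rfl, rfl, h⟩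
  · -- `u = (p, 0)` below... impossible: then `v = (q, 1)` is a lower or side neighbour
    exfalso
    simp only [Fin.isValue, Fin.val_zero, Nat.cast_zero, zero_add, Fin.val_one, Nat.cast_one] at hsum
    have hz : ((p 1 + q 1 + 1 : ℤ) : ℝ) = ((2 * x 1 : ℤ) : ℝ) := by push_cast; linarith
    have hz' : p 1 + q 1 + 1 = 2 * x 1 := by exact_mod_cast hz
    rcases h with ⟨-, h1⟩ | ⟨-, h1⟩ | ⟨-, h1⟩ <;> omega
  · simp only [Fin.isValue, Fin.val_zero, Nat.cast_zero, zero_add, Fin.val_one, Nat.cast_one] at hsum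
    have hz : ((p 1 + q 1 + 1 : ℤ) : ℝ) = ((2 * x 1 : ℤ) : ℝ) := by push_cast; linarith
    have hz' : p 1 + q 1 + 1 = 2 * x 1 := by exact_mod_cast hz
    rcases h with ⟨-, h1⟩ | ⟨-, h1⟩ | ⟨h0, h1⟩
    · omega
    · omega
    · refine ⟨q, by omega, ?_, hv⟩
      have hp : p = q - Pi.single 1 1 := (site_two_eq_iff _ _).2 ⟨by simp [h0], by simp [h1]⟩
      rw [hp]

/-! ### Half-plane arch tightness at bounded span, flat floors -/

/-- **Registered sub-goal `stub_halfPlaneArchTightness_boundedSpanFlat`** (crux item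
stmt-CriticalPhenomena-10472, line `floor-ratio-restriction-bootstrap`, anchor stub
`stub_halfPlaneArchTightness`): the anchor's statement for spans `n ≤ N₀` and vertical floor
mid-edges `s = s_x`.  Proof: `t = t_y` with `y₁ = x₁`, `0 < |y₀ - x₀| ≤ N₀`; the far mass in `Λ` is
at most the far mass in a half-strip `S_x(R) ⊇ Λ`, which is `Z_{S_x(R)} - near ≤ Z_{S_x(R)} - Z_{S_x(N₁)}`
(the vertices of `S_x(N₁)` are within `4N₁ + 4 < K n` of `mid s`), at most `ε Z_{S_x(N₁)}` by the choice
of the threshold `N₁` (tail of the convergent arch series, uniformly over the finitely many offsets),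
and `Z_{S_x(N₁)} ≤ Z_B` since `S_x(N₁) ⊆ B`. [cite: DuminilCopinSmirnov2012, Lemma 2 and §3 ("A_T ≤ 1/c_α")] -/
theorem stub_halfPlaneArchTightness_boundedSpanFlat :
    ∀ N₀ : ℕ, ∀ ε : ℝ, 0 < ε → ∃ K : ℝ, 0 < K ∧ ∀ (n : ℕ), 1 ≤ n → n ≤ N₀ →
      ∀ (Λ B : Finset HexVertex) (s t : Sym2 HexVertex),
      (∃ x : Site 2, s = s((x - Pi.single 1 1, 1), (x, 0))) →
      s ∈ hexDomainBoundary Λ → t ∈ hexDomainBoundary Λ → s ≠ t →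
      dist (hexMidpoint s) (hexMidpoint t) ≤ n → (hexMidpoint t).im = (hexMidpoint s).im →
      (∀ v ∈ Λ, (hexMidpoint s).im < (hexCenter v).im) →
      (∀ v : HexVertex, v ∈ B ↔ ((hexMidpoint s).im < (hexCenter v).im ∧
        dist (hexCenter v) (hexMidpoint s) ≤ 2 * K * n)) →
      (∑ γ : HexMidEdgeSAW Λ s t, if ∃ v ∈ γ.verts, K * n ≤ dist (hexCenter v) (hexMidpoint s)
        then hexCriticalFugacity ^ γ.length else 0) ≤
      ε * ∑ γ : HexMidEdgeSAW B s t, hexCriticalFugacity ^ γ.length := by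
  intro N₀ ε hε
  -- thresholds, uniformly over the offsets `|d| ≤ N₀`
  have hth : ∀ d : ℤ, ∃ N : ℕ, d ≠ 0 → ∀ N' : ℕ, N ≤ N' → |d| ≤ N' + 1 → ∀ R : ℕ,
      ∑ P ∈ (midWalks (stripV (R + 1) (R + 1))).filter
          (fun P => finalDart P = ((d, 0, false), (d, -1, true)) ∨
            finalDart P = ((d, -1, true), (d, 0, false))), hexCriticalFugacity ^ mwLen P ≤
        (1 + ε) * ∑ P ∈ (midWalks (stripV (N' + 1) (N' + 1))).filter
          (fun P => finalDart P = ((d, 0, false), (d, -1, true)) ∨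
            finalDart P = ((d, -1, true), (d, 0, false))), hexCriticalFugacity ^ mwLen P := by
    intro d
    by_cases hd : d = 0
    · exact ⟨0, fun h => (h hd).elim⟩
    · obtain ⟨N, hN⟩ := exists_archThreshold d hd ε hε
      exact ⟨N, fun _ => hN⟩
  choose Nf hNf using hth
  set N₁ : ℕ := max N₀ ((Finset.Icc (-(N₀ : ℤ)) N₀).sup Nf) with hN₁
  refine ⟨4 * (N₁ : ℝ) + 5, by positivity, ?_⟩
  rintro n hn hnN Λ B s t ⟨x, rfl⟩ - ht hst hdist him habove hB
  have hΛ : ∀ v ∈ Λ, x 1 ≤ v.1 1 := rows_of_forall_im_lt habove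
  obtain ⟨y, hy1, rfl, -⟩ := eq_floorEdge_of_boundary hΛ ht him
  set d : ℤ := y 0 - x 0 with hd
  have hd0 : d ≠ 0 := by
    intro h
    apply hst
    rw [(site_two_eq_iff y x).2 ⟨by omega, hy1⟩]
  have hn1 : (1 : ℝ) ≤ n := by exact_mod_cast hn
  have hdN₀ : |d| ≤ N₀ := by
    have h1 : |((y 0 - x 0 : ℤ) : ℝ)| ≤ N₀ := by
      have h2 := dist_hexMidpoint_floorEdge x y hy1
      push_cast at h2 ⊢
      rw [abs_sub_comm, ← h2]
      exact hdist.trans (by exact_mod_cast hnN)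
    rw [Int.cast_abs.symm] at h1
    exact_mod_cast h1
  have hNf₁ : Nf d ≤ N₁ :=
    (Finset.le_sup (f := Nf) (Finset.mem_Icc.2 (abs_le.1 hdN₀))).trans (le_max_right _ _)
  have hN₀₁ : N₀ ≤ N₁ := le_max_left _ _
  have hdN₁ : |d| ≤ (N₁ : ℤ) + 1 := by omega
  -- a half-strip containing `Λ`
  obtain ⟨R, hR, hΛR⟩ := exists_subset_halfStrip Λ x hΛ N₁
  have hdR : |d| ≤ (R : ℤ) + 1 := by omega
  -- the scale `K n`
  have hKn : (4 * (N₁ : ℝ) + 4) < (4 * (N₁ : ℝ) + 5) * n := by nlinarith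
  have h2Kn : (4 * (N₁ : ℝ) + 4) ≤ 2 * (4 * (N₁ : ℝ) + 5) * n := by nlinarith
  -- `S_x(N₁) ⊆ B`
  have hSB : (stripV (N₁ + 1) (N₁ + 1)).map
      (hvIso.trans (shift (-(x 0)) (-(x 1)))).symm.toEquiv.toEmbedding ⊆ B := by
    rintro ⟨z, i⟩ hw
    obtain ⟨hrow, hdist'⟩ := halfStrip_geometry hw
    exact (hB _).2 ⟨(im_hexMidpoint_lt_im_hexCenter_iff x z i).2 hrow, hdist'.trans h2Kn⟩
  -- the vertices of `S_x(N₁)` are near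
  have hnear : ∀ w ∈ (stripV (N₁ + 1) (N₁ + 1)).map
      (hvIso.trans (shift (-(x 0)) (-(x 1)))).symm.toEquiv.toEmbedding,
      dist (hexCenter w) (hexMidpoint s((x - Pi.single 1 1, 1), (x, 0))) <
        (4 * (N₁ : ℝ) + 5) * n := fun w hw => (halfStrip_geometry hw).2.trans_lt hKn
  -- the identification of the half-strip masses with the coded sums
  have heR := archMass_halfStrip_eq x y R hy1 (floorUp_mem_halfStrip hy1 hdR)
  have heN := archMass_halfStrip_eq x y N₁ hy1 (floorUp_mem_halfStrip hy1 hdN₁)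
  have hmain := hNf d hd0 N₁ hNf₁ hdN₁ R
  rw [← hd] at heR heN
  rw [← heR, ← heN] at hmain
  -- the chain
  have hsplit := farArchMass_add_nearArchMass ((stripV (R + 1) (R + 1)).map
      (hvIso.trans (shift (-(x 0)) (-(x 1)))).symm.toEquiv.toEmbedding)
    s((x - Pi.single 1 1, 1), (x, 0)) s((y - Pi.single 1 1, 1), (y, 0)) ((4 * (N₁ : ℝ) + 5) * n)
  have hnearle := archMass_le_nearArchMass (halfStrip_mono x hR)
    s((x - Pi.single 1 1, 1), (x, 0)) s((y - Pi.single 1 1, 1), (y, 0)) _ hnear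
  calc _ ≤ _ := farArchMass_mono hΛR _ _ _
    _ ≤ ε * ∑ γ : HexMidEdgeSAW ((stripV (N₁ + 1) (N₁ + 1)).map
          (hvIso.trans (shift (-(x 0)) (-(x 1)))).symm.toEquiv.toEmbedding)
          s((x - Pi.single 1 1, 1), (x, 0)) s((y - Pi.single 1 1, 1), (y, 0)),
          hexCriticalFugacity ^ γ.length := by linarith
    _ ≤ _ := mul_le_mul_of_nonneg_left (archMass_mono hSB _ _) hε.le

end Summit.CriticalPhenomena.SAWScalingLimit.Theorems.ObservableToSLE.FloorRatio

end
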